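import Summits.ResolutionOfSingularities.ResolutionOfSingularities.Theorems.WeightedInvariantContactCylinderDefs
import Summits.ResolutionOfSingularities.ResolutionOfSingularities.Theorems.WeightedInvariantContactCylinderValue
import Summits.ResolutionOfSingularities.ResolutionOfSingularities.Theorems.WeightedInvariantRegularParameterExtension
import Summits.ResolutionOfSingularities.ResolutionOfSingularities.Theorems.WeightedInvariantHypersurfaceCentreAlgebraize
import HarnessLib

/-!
# The LOCAL (pres) conjunct of the canonical game clause for the cylinder construction — zero weights on the cylinder
# directions (door `HypersurfaceCentreConstruction`, stmt-ResolutionOfSingularities-19897; KEY `stub_localWeightedDropEFT4S`,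
# rung P3 = `PRung 3`, regime P3a; res-type-005, (o28) lead object (P3a-7)(B), HOME/STATUS 2026-08-27T11:31:40Z)

Topic: `Summits/ResolutionOfSingularities/ResolutionOfSingularities/Theorems`. Helper for the door item
`HypersurfaceCentreConstruction` (stmt-ResolutionOfSingularities-19897, route `WeightedInvariant`), def-free.  The (pres)
block of `CanonicalGameClauseLE d p ι J` (`…LocalGameEFT4SDimLE`, res-type-061 p522114) reads, at a position `(S, f)` with
centre `P`:

  `∃ n (u : Fin n → S) (w : Fin n → ℕ), span (range u) = 𝔪_S ∧ 𝔪_S.spanFinrank = n ∧ (∃ i, 0 < w i) ∧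
     span {u_i | 0 < w_i} = P ∧ ∀ m, weightedMonomialIdeal u w m = J S f m ∧ (adm) ∧ (drop over cobordantAlgebra' u w)`

— a FULL minimal system of generators, the centre being its positively weighted part.  In regime P3a of ORDER (o28) the
centre of the cylinder construction `J = jCylinder ι J₀` (p524206) is the stratum prime `P = (x, g)` of the top `ι`-stratum,
generated by two elements with independent differentials, and the cylinder VALUE is the two-parameter weighted filtration
`(x, g; 1, b)_m` (res-D-brk-1's (P3a-1) `cylinder_comap_eq_weightedMonomialIdeal`, p522408, for `J₀ = jContact`,
`b = b_max` of `S_P`).  This file produces the literal (pres) data from those two facts: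

* `weightedMonomialIdeal_append_zero` — padding a weighted family by weight-`0` members does not change the weighted pieces
  (`weightedMonomialIdeal_eq_comp_of_forall_mem_range`, …CentreAlgebraize);
* `setOf_pos_weight_append` — the positively weighted members of `(x, g, y; 1, b, 0)` are `{x, g}` (`b ≥ 1`);
* **`cylinder_pres_local`** (parametric `ι`, `J₀`): `u = Fin.append ![x, g] y` a minimal system of generators EXTENDING
  `(x, g)` (`RspExtension.exists_rsp_extension`, p528548), `w = Fin.append ![1, b] 0`, and
  `weightedMonomialIdeal u w m = jCylinder ι J₀ S f m` for all `m`;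
* `cylinder_pres_local_jContact` / `…_of_essFiniteType` — the instances over p522408 (`J₀ = jContact`, `b = b_max (f/1)`
  in `S_P`; at positions essentially of finite type over a field the binder `1 ≤ b_max` is discharged there).

So, GIVEN the ι-side identification `topStratum ι S f = V(x, g)` (the (strat) conjunct, design-dependent), the first five
conjuncts of the (pres) block hold for `(ι, jCylinder ι jContact)` at every P3a position, with THE weight vector
`(1, b_max, 0, …, 0)` over which the (drop) conjunct is then to be read.  [OURS · L1 W4.3 · (o28)/(P3a-7)]  Replaces the role of
NO printed item; NOT a statement of the manuscript [claim: Hironaka2017, status: under-review]. AI work, weaker than expert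
review.

## References

* H. Matsumura, Commutative Ring Theory (1987), Thm. 14.2 (regular systems of parameters). [Matsumura1987]
* J. Włodarczyk, Functorial resolution except for toroidal locus. Toroidal compactification, Adv. Math. 407 (2022),
  Lemma 2.1.12 (weighted monomial ideals). [Wlodarczyk2022]
* res-L1-w43-plan-1, `CRUX-PLAN.md` §v7.2; res-type-061 `…LocalGameEFT4SDimLE` (`CanonicalGameClauseLE`) (OURS, AI planning).
-/

noncomputable section

open IsLocalRing Literature.AlgebraicGeometry.Resolution
open Summit.ResolutionOfSingularities.ResolutionOfSingularities.Cruxes.HypersurfaceCentreConstruction.LocalEngine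

set_option linter.dupNamespace false -- mandated namespace of this single-conjunct summit

namespace Summit.ResolutionOfSingularities.ResolutionOfSingularities.Theorems

namespace ContactCylinder

/-! ## Padding by weight-zero members -/

section Padding

variable {S : Type}

/-- **Weight-`0` padding does not change the weighted pieces**: `(x, g, y₁, …, y_r; 1, b, 0, …, 0)_m = (x, g; 1, b)_m`.
[cite: Wlodarczyk2022, Lemma 2.1.12] -/
theorem weightedMonomialIdeal_append_zero [CommRing S] (x g : S) {r : ℕ} (y : Fin r → S) (b m : ℕ) :
    weightedMonomialIdeal (Fin.append ![x, g] y) (Fin.append ![1, b] (fun _ : Fin r => 0)) m =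
      weightedMonomialIdeal ![x, g] ![1, b] m := by
  rw [weightedMonomialIdeal_eq_comp_of_forall_mem_range (Fin.append ![x, g] y) (Fin.append ![1, b] fun _ => 0)
    (Fin.castAdd r) (Fin.castAdd_injective 2 r) ?_ m]
  · have hu : Fin.append ![x, g] y ∘ Fin.castAdd r = ![x, g] := funext fun j => by
      simp only [Function.comp_apply, Fin.append_left]
    have hw : (Fin.append ![1, b] fun _ : Fin r => 0) ∘ Fin.castAdd r = ![1, b] := funext fun j => by
      simp only [Function.comp_apply, Fin.append_left]
    rw [hu, hw]
  · intro i hi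
    induction i using Fin.addCases with
    | left j => exact ⟨j, rfl⟩
    | right j =>
      rw [Fin.append_right] at hi
      exact absurd hi (lt_irrefl 0)

/-- **The positively weighted members of `(x, g, y; 1, b, 0)` are `x` and `g`** (`b ≥ 1`). [folklore] -/
theorem setOf_pos_weight_append (x g : S) {r : ℕ} (y : Fin r → S) {b : ℕ} (hb : 1 ≤ b) :
    {z | ∃ i, 0 < (Fin.append ![1, b] (fun _ : Fin r => 0) : Fin (2 + r) → ℕ) i ∧ z = Fin.append ![x, g] y i} =
      {x, g} := by
  ext z
  simp only [Set.mem_setOf_eq, Set.mem_insert_iff, Set.mem_singleton_iff]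
  constructor
  · rintro ⟨i, hi, rfl⟩
    induction i using Fin.addCases with
    | left j =>
      rw [Fin.append_left]
      fin_cases j
      · exact Or.inl rfl
      · exact Or.inr rfl
    | right j =>
      rw [Fin.append_right] at hi
      exact absurd hi (lt_irrefl 0)
  · rintro (rfl | rfl)
    · exact ⟨Fin.castAdd r 0, by rw [Fin.append_left]; exact Nat.one_pos, by rw [Fin.append_left]; rfl⟩
    · exact ⟨Fin.castAdd r 1, by rw [Fin.append_left]; exact hb, by rw [Fin.append_left]; rfl⟩

end Padding

/-! ## The local (pres) conjunct for the cylinder construction -/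

section PresLocal

/-- **(P3a-7) THE LOCAL (pres) CONJUNCT WITH ZERO WEIGHTS.**  Let `(S, 𝔪)` be a Noetherian local ring, `x, g ∈ 𝔪` with
independent differentials, `P = (x, g)` prime, and suppose the top `ι`-stratum of `f` is `V(P)` and the cylinder over `P`
has the two-parameter value `cylinderAt J₀ S P f m = (x, g; 1, b)_m` for all `m` (`b ≥ 1`).  Then the (pres) data of
`CanonicalGameClauseLE d` exist for `J = jCylinder ι J₀` at `(S, f)` with centre `P`: a minimal system of generators
`u = (x, g, y₁, …, y_r)` of `𝔪` (`spanFinrank 𝔪 = 2 + r`) and weights `w = (1, b, 0, …, 0)`, some weight positive, positively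
weighted part generating `P`, and `weightedMonomialIdeal u w m = jCylinder ι J₀ S f m` for every `m`.
[OURS · L1 W4.3 · (o28)/(P3a-7)] -/
theorem cylinder_pres_local (ι : (R : Type) → [CommRing R] → R → Ordinal.{0})
    (J : (R : Type) → [CommRing R] → R → ℕ → Ideal R) (S : Type) [CommRing S] [IsLocalRing S] [IsNoetherianRing S]
    (x g : S) (hxg : ∀ i, (![x, g] : Fin 2 → S) i ∈ maximalIdeal S)
    (hli : LinearIndependent (ResidueField S) fun i => (maximalIdeal S).toCotangent ⟨(![x, g] : Fin 2 → S) i, hxg i⟩)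
    [(Ideal.span {x, g}).IsPrime] (f : S) (hE : topStratum ι S f = {𝔮 | Ideal.span {x, g} ≤ 𝔮.asIdeal})
    {b : ℕ} (hb : 1 ≤ b)
    (hval : ∀ m, cylinderAt J S (Ideal.span {x, g}) f m = weightedMonomialIdeal ![x, g] ![1, b] m) :
    ∃ (n : ℕ) (u : Fin n → S) (w : Fin n → ℕ),
      Ideal.span (Set.range u) = maximalIdeal S ∧ (maximalIdeal S).spanFinrank = n ∧ (∃ i, 0 < w i) ∧
      Ideal.span {z | ∃ i, 0 < w i ∧ z = u i} = Ideal.span {x, g} ∧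
      ∀ m, weightedMonomialIdeal u w m = jCylinder ι J S f m := by
  obtain ⟨r, y, -, hspan, hrank⟩ := RspExtension.exists_rsp_extension S ![x, g] hxg hli
  refine ⟨2 + r, Fin.append ![x, g] y, Fin.append ![1, b] (fun _ => 0), hspan, hrank,
    ⟨Fin.castAdd r 0, by rw [Fin.append_left]; exact Nat.one_pos⟩, by rw [setOf_pos_weight_append x g y hb],
    fun m => ?_⟩
  rw [weightedMonomialIdeal_append_zero, ← hval m, jCylinder_eq_of_topStratum_eq ι J S f m hE, cylinderAt_def]

/-- **(P3a-7) for the pair of record `(ι, jCylinder ι jContact)`** at a regular local `R`: with res-D-brk-1's (P3a-1) value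
(`cylinder_comap_eq_weightedMonomialIdeal`, p522408) — `f/1 ≠ 0` not of monomial type in `R_P`, `g/1` a terminal contact
parameter there, `b = b_max (f/1) ≥ 1` — the local (pres) data exist with weights `(1, b_max, 0, …, 0)`.
[OURS · L1 W4.3 · (o28)/(P3a-7)] -/
theorem cylinder_pres_local_jContact (ι : (R : Type) → [CommRing R] → R → Ordinal.{0}) (R : Type) [CommRing R]
    [IsRegularLocalRing R] (x g : R) (hxg : ∀ i, (![x, g] : Fin 2 → R) i ∈ maximalIdeal R)
    (hli : LinearIndependent (ResidueField R) fun i => (maximalIdeal R).toCotangent ⟨(![x, g] : Fin 2 → R) i, hxg i⟩)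
    [(Ideal.span {x, g}).IsPrime] (f : R) (hE : topStratum ι R f = {𝔮 | Ideal.span {x, g} ≤ 𝔮.asIdeal})
    (hf0 : algebraMap R (Localization.AtPrime (Ideal.span {x, g})) f ≠ 0)
    (hnm : ¬ IsMonomialType (algebraMap R (Localization.AtPrime (Ideal.span {x, g})) f))
    (hreach : algebraMap R (Localization.AtPrime (Ideal.span {x, g})) f ∈
      contactFiltration (algebraMap R (Localization.AtPrime (Ideal.span {x, g})) g)
        (bMax (algebraMap R (Localization.AtPrime (Ideal.span {x, g})) f))
        (bMax (algebraMap R (Localization.AtPrime (Ideal.span {x, g})) f) *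
          (adicOrder (algebraMap R (Localization.AtPrime (Ideal.span {x, g})) f)).toNat))
    (hb : 1 ≤ bMax (algebraMap R (Localization.AtPrime (Ideal.span {x, g})) f)) :
    ∃ (n : ℕ) (u : Fin n → R) (w : Fin n → ℕ),
      Ideal.span (Set.range u) = maximalIdeal R ∧ (maximalIdeal R).spanFinrank = n ∧ (∃ i, 0 < w i) ∧
      Ideal.span {z | ∃ i, 0 < w i ∧ z = u i} = Ideal.span {x, g} ∧
      ∀ m, weightedMonomialIdeal u w m = jCylinder ι jContact R f m :=
  cylinder_pres_local ι jContact R x g hxg hli f hE hb fun m => by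
    rw [cylinderAt_def]
    exact cylinder_comap_eq_weightedMonomialIdeal R x g hxg hli f hf0 hnm hreach hb m

/-- **(P3a-7) at the door's positions** (`R` essentially of finite type over a field `k₀`): the binder `1 ≤ b_max` is
discharged by `cylinder_comap_eq_weightedMonomialIdeal_of_essFiniteType` (p522408). [OURS · L1 W4.3 · (o28)/(P3a-7)] -/
theorem cylinder_pres_local_jContact_of_essFiniteType (ι : (R : Type) → [CommRing R] → R → Ordinal.{0}) (R : Type)
    [CommRing R] [IsRegularLocalRing R] (k₀ : Type) [Field k₀] [Algebra k₀ R] [Algebra.EssFiniteType k₀ R] (x g : R)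
    (hxg : ∀ i, (![x, g] : Fin 2 → R) i ∈ maximalIdeal R)
    (hli : LinearIndependent (ResidueField R) fun i => (maximalIdeal R).toCotangent ⟨(![x, g] : Fin 2 → R) i, hxg i⟩)
    [(Ideal.span {x, g}).IsPrime] (f : R) (hE : topStratum ι R f = {𝔮 | Ideal.span {x, g} ≤ 𝔮.asIdeal})
    (hf0 : algebraMap R (Localization.AtPrime (Ideal.span {x, g})) f ≠ 0)
    (hnm : ¬ IsMonomialType (algebraMap R (Localization.AtPrime (Ideal.span {x, g})) f))
    (hreach : algebraMap R (Localization.AtPrime (Ideal.span {x, g})) f ∈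
      contactFiltration (algebraMap R (Localization.AtPrime (Ideal.span {x, g})) g)
        (bMax (algebraMap R (Localization.AtPrime (Ideal.span {x, g})) f))
        (bMax (algebraMap R (Localization.AtPrime (Ideal.span {x, g})) f) *
          (adicOrder (algebraMap R (Localization.AtPrime (Ideal.span {x, g})) f)).toNat)) :
    ∃ (n : ℕ) (u : Fin n → R) (w : Fin n → ℕ),
      Ideal.span (Set.range u) = maximalIdeal R ∧ (maximalIdeal R).spanFinrank = n ∧ (∃ i, 0 < w i) ∧
      Ideal.span {z | ∃ i, 0 < w i ∧ z = u i} = Ideal.span {x, g} ∧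
      ∀ m, weightedMonomialIdeal u w m = jCylinder ι jContact R f m :=
  cylinder_pres_local_jContact ι R x g hxg hli f hE hf0 hnm hreach
    (cylinder_comap_eq_weightedMonomialIdeal_of_essFiniteType R x g hxg hli k₀ f hf0 hnm hreach 0).1

end PresLocal

end ContactCylinder

end Summit.ResolutionOfSingularities.ResolutionOfSingularities.Theorems

end
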